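import Mathlib
import Summits.MatrixMultiplication.Statement
import Summits.MatrixMultiplication.MatrixMultiplication.Theorems.GraphEquationsIsotropicKernel

/-!
# Graph equations — the DEGREE LADDER of `MultiplicityReduction` after `[ω₃ = ω]` (M67)

Decomp-mm node «GraphEquations» (lens 5 «finite range + asymptotic regime + bridge», g42); attacked
leaf `MultiplicityReduction` (stmt-MatrixMultiplication-27806).  Target VERBATIM:
`_root_.MatrixMultiplication`.  Route-neutral (`closes` unchanged).

M66 proved `CubicEquationsForceMultiplication` (`[ω₃ = ω]`), so the crux is now
`MultiplicityReduction ↔ CubicDegreeReduction` (`= [ω ≤ ω_v]`).  This file re-cuts the remaining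
crux by TEST DEGREE — the lens's "finite range + asymptotic regime + bridge":

* FINITE RANGE (one rung per degree `D`): `EquationsForceMultiplicationDeg D` (EFM_D) — correct
  systems whose tests have total degree `≤ D` force cheap multiplication.  Rungs `D ≤ 3` are
  THEOREMS (`equationsForceMultiplicationDeg_of_le_three`, from M66); `D ≥ 4` is open
  (the pointwise-purification engine of M64 controls the linear and the TOP fibre forms of a test, and
  for `D = 3` there is nothing in between).
* BRIDGE (asymptotic regime `D = D(n) → ∞`): `BoundedDegreeReduction` (BDR) — SOME fixed test degree
  loses nothing: cheap correct systems can be replaced by cheap correct systems of ONE bounded degree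
  at any larger exponent.  `CubicDegreeReduction → BDR` (`D = 3`).
* EXACT SPLIT **`multiplicityReduction_iff_degree_ladder :
  MultiplicityReduction ↔ (∀ D, EquationsForceMultiplicationDeg D) ∧ BoundedDegreeReduction`**, and
  the summit form `matrixMultiplication_iff_degree_ladder`.

All three new notions are NEC (implied by `_root_.MatrixMultiplication`): `efmDeg_of_multiplicityReduction`,
`boundedDegreeReduction_of_cubicDegreeReduction` with M53's necessity of CDR.
-/

set_option linter.dupNamespace false

noncomputable section

namespace Summit.MatrixMultiplication.MatrixMultiplication.Theorems.GraphEquations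

open MvPolynomial Literature.Computability.AlgebraicComplexity

variable {n : ℕ}

namespace EqSystem

/-- DEGREE-`D` system: every test has total degree `≤ D`. -/
def IsDegLe (E : EqSystem n) (D : ℕ) : Prop :=
  ∀ o : Fin E.tests.length, (E.testPoly (E.tests.get o)).totalDegree ≤ D

/-- Degree `≤ 3` is `IsCubic`. -/
theorem isDegLe_three_iff {E : EqSystem n} : E.IsDegLe 3 ↔ E.IsCubic := Iff.rfl

/-- Monotonicity in the degree. -/
theorem IsDegLe.mono {E : EqSystem n} {D D' : ℕ} (h : E.IsDegLe D) (hDD' : D ≤ D') :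
    E.IsDegLe D' :=
  fun o => (h o).trans hDD'

end EqSystem

/-- `EqAdmissibleDeg D β`: correct systems with tests of degree `≤ D` and cost `O(n^β)` exist for all
`n ≥ 1`. -/
def EqAdmissibleDeg (D : ℕ) (β : ℝ) : Prop :=
  ∃ c : ℝ, ∀ n : ℕ, 1 ≤ n → ∃ E : EqSystem n, E.Correct ∧ E.IsDegLe D ∧
    (E.cost : ℝ) ≤ c * (n : ℝ) ^ β

/-- Degree `3` admissibility is cubic admissibility. -/
theorem eqAdmissibleDeg_three_iff {β : ℝ} : EqAdmissibleDeg 3 β ↔ EqAdmissibleCubic β := Iff.rfl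

/-- Monotonicity of `EqAdmissibleDeg` in the degree. -/
theorem EqAdmissibleDeg.mono_deg {D D' : ℕ} {β : ℝ} (h : EqAdmissibleDeg D β) (hDD' : D ≤ D') :
    EqAdmissibleDeg D' β := by
  obtain ⟨c, hc⟩ := h
  refine ⟨c, fun n hn => ?_⟩
  obtain ⟨E, hE, hD, hcost⟩ := hc n hn
  exact ⟨E, hE, hD.mono hDD', hcost⟩

/-- Bounded-degree admissibility implies admissibility. -/
theorem EqAdmissibleDeg.eqAdmissible {D : ℕ} {β : ℝ} (h : EqAdmissibleDeg D β) :
    EqAdmissible β := by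
  obtain ⟨c, hc⟩ := h
  refine ⟨c, fun n hn => ?_⟩
  obtain ⟨E, hE, -, hcost⟩ := hc n hn
  exact ⟨E, hE, hcost⟩

/-- **EFM_D** — rung `D` of the degree ladder: cheap correct systems with tests of degree `≤ D` force
cheap multiplication.  Rungs `D ≤ 3` are theorems (below); `D ≥ 4` open; NEC. -/
def EquationsForceMultiplicationDeg (D : ℕ) : Prop :=
  ∀ β : ℝ, 2 ≤ β → EqAdmissibleDeg D β → omega ℂ ≤ β

/-- The rungs decrease in strength as `D` decreases. -/
theorem EquationsForceMultiplicationDeg.anti {D D' : ℕ} (h : EquationsForceMultiplicationDeg D')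
    (hDD' : D ≤ D') : EquationsForceMultiplicationDeg D :=
  fun β hβ hD => h β hβ (hD.mono_deg hDD')

/-- Rung `3` is `CubicEquationsForceMultiplication`. -/
theorem equationsForceMultiplicationDeg_three_iff :
    EquationsForceMultiplicationDeg 3 ↔ CubicEquationsForceMultiplication := Iff.rfl

/-- **Rung `3` holds** (M66). -/
theorem equationsForceMultiplicationDeg_three : EquationsForceMultiplicationDeg 3 :=
  cubicEquationsForceMultiplication

/-- **The finite range `D ≤ 3` of the ladder holds.** -/
theorem equationsForceMultiplicationDeg_of_le_three {D : ℕ} (hD : D ≤ 3) :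
    EquationsForceMultiplicationDeg D :=
  equationsForceMultiplicationDeg_three.anti hD

/-- NEC: `MultiplicityReduction` (`= [ω ≤ ω_v]`) gives every rung. -/
theorem efmDeg_of_multiplicityReduction (hM : MultiplicityReduction) (D : ℕ) :
    EquationsForceMultiplicationDeg D := fun _ _ hD =>
  (multiplicityReduction_iff_omega_le_omegaVerif.mp hM).trans
    (omegaVerif_le_of_eqAdmissible hD.eqAdmissible)

/-- **BDR** — bounded degree reduction (the bridge over the asymptotic regime `D(n) → ∞`): for SOME
fixed degree `D`, cheap correct systems can be replaced by cheap correct degree-`≤ D` systems at any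
larger exponent.  Weaker than `CubicDegreeReduction` (`D = 3`); open; NEC. -/
def BoundedDegreeReduction : Prop :=
  ∃ D : ℕ, ∀ β : ℝ, 2 ≤ β → EqAdmissible β → ∀ β' : ℝ, β < β' → EqAdmissibleDeg D β'

/-- `CDR → BDR`. -/
theorem boundedDegreeReduction_of_cubicDegreeReduction (h : CubicDegreeReduction) :
    BoundedDegreeReduction :=
  ⟨3, fun β hβ hE β' hββ' => eqAdmissibleDeg_three_iff.mpr (h β hβ hE β' hββ')⟩

/-- The ladder and the bridge give the crux. -/
theorem multiplicityReduction_of_degree_ladder (hE : ∀ D, EquationsForceMultiplicationDeg D)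
    (hB : BoundedDegreeReduction) : MultiplicityReduction := by
  rw [multiplicityReduction_iff_omega_le_omegaVerif]
  obtain ⟨D, hD⟩ := hB
  refine le_csInf verifExponents_nonempty fun β hβ => ?_
  have hβ2 : 2 ≤ β := two_mem_lowerBounds_verifExponents hβ
  refine le_of_forall_gt_imp_ge_of_dense fun β' hββ' => ?_
  exact hE D β' (hβ2.trans hββ'.le) (hD β hβ2 hβ β' hββ')

/-- **EXACT SPLIT of the crux by the degree ladder:**
`MultiplicityReduction ↔ (∀ D, EFM_D) ∧ BDR`. -/
theorem multiplicityReduction_iff_degree_ladder :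
    MultiplicityReduction ↔ (∀ D, EquationsForceMultiplicationDeg D) ∧ BoundedDegreeReduction :=
  ⟨fun h => ⟨efmDeg_of_multiplicityReduction h, boundedDegreeReduction_of_cubicDegreeReduction
    (multiplicityReduction_iff_cubicDegreeReduction.mp h)⟩,
    fun h => multiplicityReduction_of_degree_ladder h.1 h.2⟩

/-- **The summit through the ladder:** `ω = 2 ↔ [ω_v = 2] ∧ (∀ D, EFM_D) ∧ BDR`. -/
theorem matrixMultiplication_iff_degree_ladder :
    _root_.MatrixMultiplication ↔ GraphEquationsQuadratic ∧
      (∀ D, EquationsForceMultiplicationDeg D) ∧ BoundedDegreeReduction := by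
  rw [matrixMultiplication_iff_quadratic_and_cdr, ← multiplicityReduction_iff_cubicDegreeReduction,
    multiplicityReduction_iff_degree_ladder]

/-- NEC: the summit gives every rung. -/
theorem efmDeg_of_matrixMultiplication (hS : _root_.MatrixMultiplication) (D : ℕ) :
    EquationsForceMultiplicationDeg D :=
  (matrixMultiplication_iff_degree_ladder.mp hS).2.1 D

/-- NEC: the summit gives the bridge. -/
theorem boundedDegreeReduction_of_matrixMultiplication (hS : _root_.MatrixMultiplication) :
    BoundedDegreeReduction :=
  (matrixMultiplication_iff_degree_ladder.mp hS).2.2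

end Summit.MatrixMultiplication.MatrixMultiplication.Theorems.GraphEquations
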